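import Summits.BirchSwinnertonDyer.Rank1Residual.P2.CongruentNumberSilentEvenFiveOddIndexDatum
import Literature.NumberTheory.EllipticCurves.Tian2014.CMPointSystemMonskyDescent
import HarnessLib

/-!
# Cell «bsd-monsky» (typer): THE ENCLOSURE — C-P2-1 (Monsky's 1990 conjecture on `𝒮⁻`) as a theorem of the tree
# relative to Monsky 1990 Cor 5.15 and the ONE system fact `tian2014_monsky1990_system_sMinus`

HONEST FRAMING (cell `bsd-monsky`, run/shared/lean/pub/bsd-monsky/; README §1): nothing asserted; the two theorems
below are CONDITIONAL on the displayed fact `hSys` (Tian's CM-point system on `𝒮⁻` with its printed properties: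
Tian 2014 Thm. 2.8, the Tian–Yuan–Zhang Thm. 3.3 index relation ((B4)-flagged, PROOF-A Lemma 8.1 + (9.1.2)), Monsky
1990 Lemma 4.1, Thm. 4.7's ambiguous class, the genus facts, Lemma 5.4 / Lemma 5.8) and on `h515` (Monsky Cor 5.15,
in the tree). Route: `hSys` gives a system `D`; `MonskyDisplays ⟹ MinusY` (Monsky Thms 4.5/4.7/5.5/5.9 (1) in Lean,
`Tian2014/CMPointSystem*.lean`); `MinusY ∧ GZ ∧ rank one ⟹ 𝓛(2pq) odd`; tier 0 (`OddIndexHeegnerDatum`) and door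
D-CN-5 give `CongruentSilentEvenFiveOrdTwo` and `CongruentSilentEvenFiveBSDTwo`. No (K) moves; the conjecture `Prop`s
stay `@[conjecture]` until the referee passes the displays and `hSys` is a Literature fact of the tree.
References: HOME `lean/PLAN.md` v0.5, `Enclosure_check.lean`; [Monsky1990MockHeegner]; [Tian2014]; [TianYuanZhang2017].
-/

noncomputable section

open scoped Classical

open WeierstrassCurve Literature.NumberTheory.EllipticCurves
  Literature.NumberTheory.EllipticCurves.Rank1Residual
  Literature.NumberTheory.EllipticCurves.Rank1Residual.Typed
  Literature.NumberTheory.EllipticCurves.Monsky1990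
  Literature.NumberTheory.EllipticCurves.TianYuanZhang2017

set_option autoImplicit false

/-! ## (Summits side) THE ENCLOSURE: C-P2-1 relative to {Monsky Cor 5.15, the one system fact} -/

namespace Summit.BirchSwinnertonDyer.Rank1Residual.P2

open Conjectures Literature.NumberTheory.EllipticCurves.Tian2014
  Literature.NumberTheory.EllipticCurves.Monsky1990

/-- The odd-index Heegner datum of tier 0 on `𝒮⁻` from the one system fact and Monsky Cor 5.15.
[cite: Monsky1990MockHeegner, Thm. 5.14 (13)/(15) (p. 66), Cor. 5.15 (2′) (p. 66)] [cite: TianYuanZhang2017, Thm. 3.3] -/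
theorem oddIndexHeegnerDatum_of_system
    (h515 : cor515_rank_eq_one_and_card_selmerGroup_two) (hSys : tian2014_monsky1990_system_sMinus) :
    ∀ p q : ℕ, p.Prime → q.Prime → p % 8 = 5 → q % 4 = 3 → jacobiSym p q = -1 →
      OddIndexHeegnerDatum (2 * (p * q)) := by
  intro p q hp hq hp5 hq4 hj
  obtain ⟨hN, -, -, -⟩ := isCor515Family_two_mul_five_mul hp hq hp5 hq4
  haveI := isElliptic_congruentNumberCurve hN.ne_zero
  have hrank : (congruentNumberCurve (2 * (p * q))).mordellWeilRank = 1 := (h515 _ hN).1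
  obtain ⟨g, hg, -⟩ := exists_generatesFreePartRat_of_mordellWeilRank_eq_one hN.ne_zero hrank
  obtain ⟨D, hP, hGZ, hM⟩ := hSys p q hp hq hp5 hq4 hj
  have hMY := D.minusY_of_monskyDisplays (Nat.mul_ne_zero hp.ne_zero hq.ne_zero) hN.squarefree hP hM
  obtain ⟨L, hLodd, hL⟩ := D.exists_odd_scriptL_of_minusY_of_grossZagier _ hGZ hMY g hg
  exact oddIndexHeegnerDatum_of_odd_scriptL hN.ne_zero hrank hLodd hL

/-- **THE ENCLOSURE: C-P2-1 relative to Monsky 1990 Cor 5.15 (`h515`, in the tree) and the ONE system fact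
`tian2014_monsky1990_system_sMinus` (Tian's CM-point system on `𝒮⁻` with its printed properties: Tian Thm. 2.8,
the TYZ Thm. 3.3 index relation ((B4)-flagged), Monsky Lemma 4.1 / Thm. 4.7 / genus facts / Lemma 5.4 / Lemma 5.8).**
Sorry-free; nothing asserted. [cite: Monsky1990MockHeegner, Cor. 5.15 (2′) (p. 66), Thm. 5.14 (13)/(15) (p. 66)]
[cite: Tian2014, Thm. 2.8 (J132)] [cite: TianYuanZhang2017, Thm. 3.3] [cite: Miller2011LMS, Def. 1.1] -/
theorem congruentSilentEvenFiveBSDTwo_of_system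
    (h515 : cor515_rank_eq_one_and_card_selmerGroup_two) (hSys : tian2014_monsky1990_system_sMinus) :
    CongruentSilentEvenFiveBSDTwo :=
  congruentSilentEvenFiveBSDTwo_of_oddIndexHeegnerDatum h515 (oddIndexHeegnerDatum_of_system h515 hSys)

end Summit.BirchSwinnertonDyer.Rank1Residual.P2

end
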